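import Literature.Computability.Complexity.PSpaceSignedSum
import Literature.Computability.Complexity.SpaceTMSATHard
import Literature.Computability.Complexity.ProbabilisticClassesProofs
import HarnessLib

/-!
# Ladner's `♮PSPACE` and its gap closure: counting polynomially long witnesses of polynomial-space relations

Topic `Literature/Computability/Complexity` (space-bounded classes of `Space.lean`; counting of
`Counting.lean`). Ladner (1989) attaches two counting classes to polynomial space: `#PSPACE`, the
numbers of accepting computations of nondeterministic polynomial-space machines with NO bound on the
number of nondeterministic moves (values up to `2^{2^{poly}}`; `#PSPACE = FPSPACE`, exponentially long
outputs allowed), and its subclass `♮PSPACE` ("natural" `PSPACE` counting) in which the machines make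
only POLYNOMIALLY MANY nondeterministic moves (`♮PSPACE = FPSPACE(poly)`, polynomial-length outputs).
This file vendors the SMALLER class `♮PSPACE`, in the tree's witness convention — `NatPSPACE`:
`f x = #{y ∈ {0,1}^{p(|x|)} | ⟨x, y⟩ ∈ R}` for a relation `R ∈ PSPACE` (exactly as `SharpP` is built on
`P`; values `< 2^{p(|x|)}`, so this is a proper subclass of Ladner's `#PSPACE`) — and the class
`GapNatPSPACE = ♮PSPACE − ♮PSPACE` of its differences, with the ring structure that the relativizing
arguments of Fenner–Fortnow–Kurtz (§3: `GapP` is closed under sums, uniform exponential sums and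
products) give verbatim for polynomial-space verifiers, and the threshold `{x | 0 < g x} ∈ PSPACE`
(the `PSPACE`-count comparison `gapThreshold_mem_PSPACE` of `PSpaceGapThreshold.lean`). This is the
integer calculus in which the polynomial-space simulator of Aaronson–Chen's Lemma 5.3 (CCC 2017,
§5.3: "all the computations can be done in `PSPACE`") evaluates the path-pair counts of its replaced
circuits, whose admissibility ("the guessed `TQBF` answers are right") is only a `PSPACE` predicate.

* `NatPSPACE` (`♮PSPACE`), `GapNatPSPACE` (definitions, witness form);
* `♮PSPACE`: `sharpP_subset_natPSPACE`, `exists_padRel_PSPACE` (padding witnesses),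
  `add_mem_NatPSPACE`, `mul_mem_NatPSPACE`, `sum_mem_NatPSPACE` (uniform exponential sums),
  `comp_mem_NatPSPACE` (`FP` preprocessing), `count_mem_NatPSPACE`; two pure `#P` lemmas used on the
  way, `natFP_mem_SharpP` (the value of an `FP` numeral) and `natConst_mem_SharpP`;
* `GapNatPSPACE`: `natPSPACE_mem_GapNatPSPACE`, `gapP_subset_gapNatPSPACE`, `add/neg/sub/mul/nsmul/zsmul/pow`,
  `const_mem_GapNatPSPACE`, `natFP_mem_GapNatPSPACE`, `two_pow_length_mem_GapNatPSPACE`,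
  `two_pow_mem_GapNatPSPACE`, `sum_mem_GapNatPSPACE`, `comp_mem_GapNatPSPACE`, `ite_mem_GapNatPSPACE`
  (restriction to a `PSPACE` set);
* thresholds: **`pos_mem_PSPACE`** (`{x | 0 < g x} ∈ PSPACE`), `neg_mem_PSPACE`, `nonneg`, `nonpos`,
  `setOf_lt_mem_PSPACE` (`{x | g₁ x < g₂ x}`), `setOf_eq_mem_PSPACE`.

All theorems proved; the only definitions are the two classes.

## References

* R. E. Ladner, *Polynomial space counting problems*, SIAM J. Comput. 18 (1989) 1087–1097, §1
  (the classes `#PSPACE` and `♮PSPACE`; `#PSPACE = FPSPACE`, `♮PSPACE = FPSPACE(poly)`) [Ladner1989].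
* S. Fenner, L. Fortnow, S. Kurtz, *Gap-definable counting classes*, JCSS 48 (1994), §3
  (closure of gap classes under subtraction, sums and products; the proofs relativize), Prop. 4.2
  (thresholds) [FennerFortnowKurtz1994].
* S. Arora, B. Barak, *Computational Complexity: A Modern Approach*, CUP 2009, Def. 17.2
  (witness counting; padding witnesses), §4.1 (`PSPACE` absorbs `P`) [AroraBarakCC2009].
-/

noncomputable section

namespace Literature.Computability.Complexity

open _root_.Computability Polynomial TTClosure PPSharpP PPGapP Brick Plumb OracleCompose PRelSigma
open scoped Classical

/-! ### The classes -/

/-- **Ladner's `♮PSPACE`** ("natural" polynomial-space counting) in witness form: the functions `f`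
with `f x = #{y ∈ {0,1}^{p(|x|)} | ⟨x, y⟩ ∈ R}` for a relation `R ∈ PSPACE` and a polynomial `p` —
polynomially many guessed bits, verified in polynomial space. This is a PROPER SUBCLASS of Ladner's
`#PSPACE` (no bound on the nondeterministic moves, `= FPSPACE` with exponentially long values): here
`f x < 2^{p(|x|)}`, and Ladner's theorem for this class reads `♮PSPACE = FPSPACE(poly)`.
[cite: Ladner1989, §1 (the class ♮PSPACE; ♮PSPACE = FPSPACE(poly))] -/
def NatPSPACE : Set (List Bool → ℕ) :=
  {f | ∃ R ∈ PSPACE, ∃ p : Polynomial ℕ, ∀ x : List Bool, f x = countWitnesses R (p.eval x.length) x}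

/-- **The gap class `GapNatPSPACE = ♮PSPACE − ♮PSPACE`** of differences of two `♮PSPACE` functions (the
polynomial-space-verifier twin of `GapP`). [cite: FennerFortnowKurtz1994, §3 (gap classes)] [cite: Ladner1989, §1 (the class ♮PSPACE)] -/
def GapNatPSPACE : Set (List Bool → ℤ) :=
  {g | ∃ f₁ ∈ NatPSPACE, ∃ f₂ ∈ NatPSPACE, ∀ x : List Bool, g x = (f₁ x : ℤ) - (f₂ x : ℤ)}

/-! ### `♮PSPACE`: containment of `#P`, padding, sums and products -/

/-- `#P ⊆ ♮PSPACE` (`P ⊆ PSPACE`). [cite: AroraBarakCC2009, §4.1] -/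
theorem sharpP_subset_natPSPACE : SharpP ⊆ NatPSPACE := by
  rintro f ⟨R, hR, p, hf⟩
  exact ⟨R, P_subset_PSPACE_holds hR, p, hf⟩

/-- **Padded relation** (witness length read off `|u|`): for `R ∈ PSPACE` and `r` there is
`Rp ∈ PSPACE` with `⟨u, y'⟩ ∈ Rp ↔ ⟨u, y'↾r(|u|)⟩ ∈ R ∧ y'⇂r(|u|) = 1^*`; the `PSPACE` twin of
`SharpPClosure.exists_padRel`. [cite: AroraBarakCC2009, Def. 17.2 (padding witnesses)] -/
theorem exists_padRel_PSPACE (r : Polynomial ℕ) {R : Language Bool} (hR : R ∈ PSPACE) :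
    ∃ Rp : Language Bool, Rp ∈ PSPACE ∧ ∀ u y' : List Bool, boolPair u y' ∈ Rp ↔
      boolPair u (y'.take (r.eval u.length)) ∈ R ∧
        y'.drop (r.eval u.length) = List.replicate (y'.length - r.eval u.length) true := by
  have hf : (sndP ∘ dropSndFn r) ∈ FP := comp_mem_FP sndP_mem_FP (dropSndFn_mem_FP r)
  have hg : (onesFn ∘ (sndP ∘ dropSndFn r)) ∈ FP := comp_mem_FP onesFn_mem_FP hf
  refine ⟨({w | (sndP ∘ dropSndFn r) w = (onesFn ∘ (sndP ∘ dropSndFn r)) w} : Language Bool) ⊓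
      (truncSndFn r ⁻¹' R : Language Bool),
    inter_P_mem_PSPACE (setOf_apply_eq_apply_mem_P hf hg) (preimage_mem_PSPACE hR (truncSndFn_mem_FP r)),
    fun u y' => ?_⟩
  rw [Language.mem_inf, memL_preimage, truncSndFn_boolPair, StockMachine.memL_setOf, Function.comp_apply,
    Function.comp_apply, Function.comp_apply, dropSndFn_boolPair, sndP_boolPair, onesFn_eq_replicate,
    List.length_drop]
  exact and_comm

/-- **`♮PSPACE` is closed under addition**: pad both relations to the common witness length
`(q₁ + q₂)(|x|)` and branch on one more witness bit (`PSpaceGap.exists_sumRel`).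
[cite: FennerFortnowKurtz1994, §3 (closure properties, proof of Prop. 3.5)] -/
theorem add_mem_NatPSPACE {f h : List Bool → ℕ} (hf : f ∈ NatPSPACE) (hh : h ∈ NatPSPACE) :
    (fun x => f x + h x) ∈ NatPSPACE := by
  obtain ⟨B, hB⟩ := exists_isComplete_PSPACE_holds
  obtain ⟨R₁, hR₁, q₁, hf₁⟩ := hf
  obtain ⟨R₂, hR₂, q₂, hf₂⟩ := hh
  obtain ⟨R₁p, hR₁p, hspec₁⟩ := exists_padRel_PSPACE q₁ hR₁
  obtain ⟨R₂p, hR₂p, hspec₂⟩ := exists_padRel_PSPACE q₂ hR₂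
  have hc₁ : ∀ x : List Bool, countWitnesses R₁p ((q₁ + q₂).eval x.length) x = f x := fun x => by
    rw [hf₁ x]
    exact countWitnesses_of_padSpec R₁ R₁p x (q₁.eval x.length) (hspec₁ x) (by simp [eval_add])
  have hc₂ : ∀ x : List Bool, countWitnesses R₂p ((q₁ + q₂).eval x.length) x = h x := fun x => by
    rw [hf₂ x]
    exact countWitnesses_of_padSpec R₂ R₂p x (q₂.eval x.length) (hspec₂ x) (by simp [eval_add])
  obtain ⟨R, hR, h0, h1⟩ := PSpaceGap.exists_sumRel hB hR₁p hR₂p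
  refine ⟨R, hR, q₁ + q₂ + 1, fun x => ?_⟩
  show f x + h x = countWitnesses R ((q₁ + q₂ + 1).eval x.length) x
  rw [eval_add, eval_one, countWitnesses_sumRel h0 h1, hc₁, hc₂]

/-- **`♮PSPACE` is closed under products**: witnesses `y₁ y₂` of length `(q₁ + q₂)(|x|)` for the
relation `trunc_{q₁}⁻¹ R₁ ⊓ drop_{q₁}⁻¹ R₂`, whose count is the product (`cnt_take_drop`).
[cite: FennerFortnowKurtz1994, §3 (closure of gap classes under products)] -/
theorem mul_mem_NatPSPACE {f h : List Bool → ℕ} (hf : f ∈ NatPSPACE) (hh : h ∈ NatPSPACE) :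
    (fun x => f x * h x) ∈ NatPSPACE := by
  obtain ⟨B, hB⟩ := exists_isComplete_PSPACE_holds
  obtain ⟨R₁, hR₁, q₁, hf₁⟩ := hf
  obtain ⟨R₂, hR₂, q₂, hf₂⟩ := hh
  refine ⟨(truncSndFn q₁ ⁻¹' R₁ : Language Bool) ⊓ (dropSndFn q₁ ⁻¹' R₂ : Language Bool),
    inter_mem_PSPACE_of_complete hB (preimage_mem_PSPACE hR₁ (truncSndFn_mem_FP q₁))
      (preimage_mem_PSPACE hR₂ (dropSndFn_mem_FP q₁)),
    q₁ + q₂, fun x => ?_⟩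
  show f x * h x = countWitnesses _ ((q₁ + q₂).eval x.length) x
  rw [hf₁ x, hf₂ x, countWitnesses_eq_cnt, countWitnesses_eq_cnt, countWitnesses_eq_cnt, eval_add,
    ← cnt_take_drop]
  refine cnt_congr fun y _ => ?_
  simp only [Set.mem_setOf_eq]
  rw [Language.mem_inf, memL_preimage, memL_preimage, truncSndFn_boolPair, dropSndFn_boolPair]

/-- The zero function is in `♮PSPACE`. [cite: AroraBarakCC2009, Def. 17.2] -/
theorem zero_mem_NatPSPACE : (fun _ => 0 : List Bool → ℕ) ∈ NatPSPACE :=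
  sharpP_subset_natPSPACE zero_mem_SharpP

/-- **Uniform exponential sums of a `♮PSPACE` function are in `♮PSPACE`**: for `φ ∈ ♮PSPACE` and
`g ∈ FP`, `v ↦ Σ_{z ∈ {0,1}^{|g v|}} φ(⟨v, z⟩) ∈ ♮PSPACE` (witness `z w`, `w` a padded witness of `φ`
at `⟨v, z⟩`); the `PSPACE` twin of `ParityClosure.sum_mem_SharpP`.
[cite: FennerFortnowKurtz1994, §3 (closure under uniform sums)] [cite: AroraBarakCC2009, Def. 17.2] -/
theorem sum_mem_NatPSPACE {φ : List Bool → ℕ} (hφ : φ ∈ NatPSPACE) {g : List Bool → List Bool}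
    (hg : g ∈ FP) :
    (fun v => ∑ z : List.Vector Bool (g v).length, φ (boolPair v z.toList)) ∈ NatPSPACE := by
  obtain ⟨R, hR, r, hr⟩ := hφ
  obtain ⟨s, hs⟩ := exists_poly_length_le_of_mem_FP hg
  obtain ⟨Rp, hRp, hspec⟩ := exists_padRel_PSPACE r hR
  -- the block width `W(|v|) ≥ r(|⟨v, z⟩|)` for `|z| ≤ s(|v|)`
  set W : Polynomial ℕ := r.comp (2 * X + 2 + s) with hW
  have hWge : ∀ (v z : List Bool), z.length ≤ s.eval v.length →
      r.eval (boolPair v z).length ≤ W.eval v.length := by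
    intro v z hz
    rw [hW, eval_comp]
    refine TM2Iter.eval_mono r ?_
    simp only [eval_add, eval_mul, eval_ofNat, eval_X, length_boolPair]
    omega
  -- the relation `{⟨v, u⟩ | ⟨⟨v, u↾|g v|⟩, u beyond |g v|⟩ ∈ Rp}`
  set h : List Bool → List Bool := fanoutFn (fanoutFn fstF (takeFn ∘ fanoutFn (g ∘ fstF) sndF))
    (dropFn ∘ fanoutFn (g ∘ fstF) sndF) with hh
  have hhFP : h ∈ FP := fanoutFn_mem_FP
    (fanoutFn_mem_FP fstF_mem_FP (comp_mem_FP takeFn_mem_FP (fanoutFn_mem_FP (comp_mem_FP hg fstF_mem_FP) sndF_mem_FP)))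
    (comp_mem_FP dropFn_mem_FP (fanoutFn_mem_FP (comp_mem_FP hg fstF_mem_FP) sndF_mem_FP))
  have hh_apply : ∀ v u : List Bool,
      h (boolPair v u) = boolPair (boolPair v (u.take (g v).length)) (u.drop (g v).length) := by
    intro v u
    simp [hh]
  refine ⟨h ⁻¹' Rp, preimage_mem_PSPACE hRp hhFP, s + W, fun v => ?_⟩
  show ∑ z : List.Vector Bool (g v).length, φ (boolPair v z.toList) = _
  have has : (g v).length ≤ s.eval v.length := hs v
  obtain ⟨d, hd⟩ : ∃ d, (s + W).eval v.length = (g v).length + d ∧ W.eval v.length ≤ d :=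
    ⟨(s + W).eval v.length - (g v).length, by rw [eval_add]; omega, by rw [eval_add]; omega⟩
  rw [countWitnesses_eq_cnt, hd.1, cnt_add_eq_sum_vector]
  refine Finset.sum_congr rfl fun z _ => ?_
  have hz : z.toList.length = (g v).length := by simp
  have hle : r.eval (boolPair v z.toList).length ≤ d := (hWge v z.toList (by rw [hz]; exact has)).trans hd.2
  rw [hr, ← countWitnesses_of_padSpec R Rp (boolPair v z.toList) (r.eval (boolPair v z.toList).length) (hspec _) hle,
    countWitnesses_eq_cnt]
  exact cnt_congr fun w _ => by
    rw [Set.mem_setOf_eq, Set.mem_setOf_eq, Set.mem_setOf_eq, memL_preimage, hh_apply, List.take_left' hz,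
      List.drop_left' hz]

/-- **`♮PSPACE` is closed under `FP` preprocessing**: `φ ∈ ♮PSPACE`, `f ∈ FP ⇒ φ ∘ f ∈ ♮PSPACE` (the
relation `mapFst(f)⁻¹(padRel r R)` with witness length `r(s(|z|))`); twin of `comp_mem_SharpP`.
[cite: AroraBarakCC2009, Def. 17.2] -/
theorem comp_mem_NatPSPACE {φ : List Bool → ℕ} (hφ : φ ∈ NatPSPACE) {f : List Bool → List Bool}
    (hf : f ∈ FP) : (φ ∘ f) ∈ NatPSPACE := by
  obtain ⟨R, hR, r, hr⟩ := hφ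
  obtain ⟨s, hs⟩ := exists_poly_length_le_of_mem_FP hf
  obtain ⟨Rp, hRp, hspec⟩ := exists_padRel_PSPACE r hR
  -- witness length `r(s(|z|) + |z|) ≥ r(|f z|)` (monotone in the argument)
  set W : Polynomial ℕ := r.comp (s + X) with hW
  have hWge : ∀ z : List Bool, r.eval (f z).length ≤ W.eval z.length := by
    intro z
    rw [hW, eval_comp]
    exact TM2Iter.eval_mono r (by rw [eval_add, eval_X]; have := hs z; omega)
  refine ⟨pairFn (f ∘ fstP) sndP ⁻¹' Rp, preimage_mem_PSPACE hRp (pairFn_mem_FP (comp_mem_FP hf fstP_mem_FP) sndP_mem_FP),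
    W, fun z => ?_⟩
  show φ (f z) = _
  rw [hr, ← countWitnesses_of_padSpec R Rp (f z) (r.eval (f z).length) (hspec _) (hWge z), countWitnesses_eq_cnt,
    countWitnesses_eq_cnt]
  exact cnt_congr fun w _ => by
    rw [Set.mem_setOf_eq, Set.mem_setOf_eq, memL_preimage, pairFn_apply, Function.comp_apply, fstP_boolPair, sndP_boolPair]

/-- **The value of an `FP` numeral is a `#P` function**: `x ↦ ⟦t x⟧` counts the `y ∈ {0,1}^{s(|x|)}`
with `⟦y⟧ < ⟦t x⟧` (`s` an output-length bound of `t`, so that `⟦t x⟧ < 2^{s(|x|)}`; `cnt_val_lt`).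
[cite: FennerFortnowKurtz1994, §3 (FP ⊆ GapP)] -/
theorem natFP_mem_SharpP {t : List Bool → List Bool} (ht : t ∈ FP) : (fun x => bitsToNat (t x)) ∈ SharpP := by
  obtain ⟨s, hs⟩ := exists_poly_length_le_of_mem_FP ht
  have hg : (ltFn ∘ pairFn sndP (t ∘ fstP)) ∈ FP :=
    comp_mem_FP ltFn_mem_FP (pairFn_mem_FP sndP_mem_FP (comp_mem_FP ht fstP_mem_FP))
  have hg_apply : ∀ w, (ltFn ∘ pairFn sndP (t ∘ fstP)) w = [decide (bitsToNat (sndP w) < bitsToNat (t (fstP w)))] := by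
    intro w
    simp only [Function.comp_apply, pairFn_apply, ltFn_boolPair]
  have hL : ({z | bitsToNat (sndP z) < bitsToNat (t (fstP z))} : Language Bool) ∈ Classes.P :=
    mem_P_of_mem_FP hg _ fun w => by
      constructor
      · intro h
        rw [hg_apply, decide_eq_true (show bitsToNat (sndP w) < bitsToNat (t (fstP w)) from h)]
      · intro h
        rw [hg_apply, decide_eq_false (show ¬ bitsToNat (sndP w) < bitsToNat (t (fstP w)) from h)]
  refine ⟨{z | bitsToNat (sndP z) < bitsToNat (t (fstP z))}, hL, s, fun x => ?_⟩
  show bitsToNat (t x) = _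
  have hlt : bitsToNat (t x) ≤ 2 ^ s.eval x.length :=
    (bitsToNat_lt (t x)).le.trans (Nat.pow_le_pow_right two_pos (hs x))
  rw [countWitnesses_eq_cnt, ← cnt_val_lt hlt]
  exact cnt_congr fun y _ => by
    change bitsToNat y < bitsToNat (t x) ↔ bitsToNat (sndP (boolPair x y)) < bitsToNat (t (fstP (boolPair x y)))
    rw [sndP_boolPair, fstP_boolPair]

/-- `x ↦ ⟦t x⟧ ∈ ♮PSPACE` for `t ∈ FP`. [cite: FennerFortnowKurtz1994, §3] -/
theorem natFP_mem_NatPSPACE {t : List Bool → List Bool} (ht : t ∈ FP) :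
    (fun x => bitsToNat (t x)) ∈ NatPSPACE :=
  sharpP_subset_natPSPACE (natFP_mem_SharpP ht)

/-- **Counting a `PSPACE` relation over the witnesses of length `|g v|`** is a `♮PSPACE` function:
`v ↦ #{z ∈ {0,1}^{|g v|} | ⟨v, z⟩ ∈ A}` (the sum of the indicator, a `♮PSPACE` function with `0`
witness bits). [cite: Ladner1989, §1 (the class ♮PSPACE)] -/
theorem count_mem_NatPSPACE {A : Language Bool} (hA : A ∈ PSPACE) {g : List Bool → List Bool} (hg : g ∈ FP) :
    (fun v => cnt (g v).length {z | boolPair v z ∈ A}) ∈ NatPSPACE := by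
  -- the indicator of `A` is `♮PSPACE` with zero witness bits
  have hind : (fun w => if w ∈ A then 1 else 0 : List Bool → ℕ) ∈ NatPSPACE := by
    refine ⟨fstP ⁻¹' A, preimage_mem_PSPACE hA fstP_mem_FP, 0, fun w => ?_⟩
    show (if w ∈ A then 1 else 0) = countWitnesses (fstP ⁻¹' A) ((0 : Polynomial ℕ).eval w.length) w
    rw [eval_zero, countWitnesses_eq_cnt, cnt_zero]
    simp [memL_preimage]
  have h := sum_mem_NatPSPACE hind hg
  refine (show (fun v => ∑ z : List.Vector Bool (g v).length, (if boolPair v z.toList ∈ A then 1 else 0)) =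
      fun v => cnt (g v).length {z | boolPair v z ∈ A} from funext fun v => ?_) ▸ h
  unfold cnt
  rw [Finset.card_filter]
  rfl

/-! ### `GapNatPSPACE` is a ring -/

/-- `♮PSPACE ⊆ GapNatPSPACE` (pointwise cast). [cite: FennerFortnowKurtz1994, Lemma 3.3] -/
theorem natPSPACE_mem_GapNatPSPACE {f : List Bool → ℕ} (hf : f ∈ NatPSPACE) : (fun x => (f x : ℤ)) ∈ GapNatPSPACE :=
  ⟨f, hf, fun _ => 0, zero_mem_NatPSPACE, fun x => by simp⟩

/-- `GapP ⊆ GapNatPSPACE`. [cite: FennerFortnowKurtz1994, §3] -/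
theorem gapP_subset_gapNatPSPACE : GapP ⊆ GapNatPSPACE := by
  rintro g ⟨f₁, hf₁, f₂, hf₂, e⟩
  exact ⟨f₁, sharpP_subset_natPSPACE hf₁, f₂, sharpP_subset_natPSPACE hf₂, e⟩

/-- **`GapNatPSPACE` is closed under addition.** [cite: FennerFortnowKurtz1994, §3 (closure properties of gap classes)] -/
theorem add_mem_GapNatPSPACE {g₁ g₂ : List Bool → ℤ} (h₁ : g₁ ∈ GapNatPSPACE) (h₂ : g₂ ∈ GapNatPSPACE) :
    (fun x => g₁ x + g₂ x) ∈ GapNatPSPACE := by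
  obtain ⟨a₁, ha₁, b₁, hb₁, e₁⟩ := h₁
  obtain ⟨a₂, ha₂, b₂, hb₂, e₂⟩ := h₂
  refine ⟨fun x => a₁ x + a₂ x, add_mem_NatPSPACE ha₁ ha₂, fun x => b₁ x + b₂ x, add_mem_NatPSPACE hb₁ hb₂,
    fun x => ?_⟩
  show g₁ x + g₂ x = ((a₁ x + a₂ x : ℕ) : ℤ) - ((b₁ x + b₂ x : ℕ) : ℤ)
  rw [e₁ x, e₂ x]
  push_cast
  ring

/-- **`GapNatPSPACE` is closed under negation.** [cite: FennerFortnowKurtz1994, §3] -/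
theorem neg_mem_GapNatPSPACE {g : List Bool → ℤ} (h : g ∈ GapNatPSPACE) : (fun x => -g x) ∈ GapNatPSPACE := by
  obtain ⟨a, ha, b, hb, e⟩ := h
  refine ⟨b, hb, a, ha, fun x => ?_⟩
  show -g x = (b x : ℤ) - (a x : ℤ)
  rw [e x]
  ring

/-- **`GapNatPSPACE` is closed under subtraction.** [cite: FennerFortnowKurtz1994, §3] -/
theorem sub_mem_GapNatPSPACE {g₁ g₂ : List Bool → ℤ} (h₁ : g₁ ∈ GapNatPSPACE) (h₂ : g₂ ∈ GapNatPSPACE) :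
    (fun x => g₁ x - g₂ x) ∈ GapNatPSPACE := by
  have h := add_mem_GapNatPSPACE h₁ (neg_mem_GapNatPSPACE h₂)
  simp only [← sub_eq_add_neg] at h
  exact h

/-- **`GapNatPSPACE` is closed under products**: `(a₁ − b₁)(a₂ − b₂) = (a₁a₂ + b₁b₂) − (a₁b₂ + b₁a₂)`.
[cite: FennerFortnowKurtz1994, §3 (closure of gap classes under products)] -/
theorem mul_mem_GapNatPSPACE {g₁ g₂ : List Bool → ℤ} (h₁ : g₁ ∈ GapNatPSPACE) (h₂ : g₂ ∈ GapNatPSPACE) :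
    (fun x => g₁ x * g₂ x) ∈ GapNatPSPACE := by
  obtain ⟨a₁, ha₁, b₁, hb₁, e₁⟩ := h₁
  obtain ⟨a₂, ha₂, b₂, hb₂, e₂⟩ := h₂
  refine ⟨fun x => a₁ x * a₂ x + b₁ x * b₂ x, add_mem_NatPSPACE (mul_mem_NatPSPACE ha₁ ha₂) (mul_mem_NatPSPACE hb₁ hb₂),
    fun x => a₁ x * b₂ x + b₁ x * a₂ x, add_mem_NatPSPACE (mul_mem_NatPSPACE ha₁ hb₂) (mul_mem_NatPSPACE hb₁ ha₂),
    fun x => ?_⟩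
  show g₁ x * g₂ x = ((a₁ x * a₂ x + b₁ x * b₂ x : ℕ) : ℤ) - ((a₁ x * b₂ x + b₁ x * a₂ x : ℕ) : ℤ)
  rw [e₁ x, e₂ x]
  push_cast
  ring

/-- The zero function is in `GapNatPSPACE`. [cite: FennerFortnowKurtz1994, §3] -/
theorem zero_mem_GapNatPSPACE : (fun _ => (0 : ℤ)) ∈ GapNatPSPACE := by
  have h := natPSPACE_mem_GapNatPSPACE zero_mem_NatPSPACE
  simpa using h

/-- Natural constants are in `#P` (the value of a constant numeral). [cite: FennerFortnowKurtz1994, §3] -/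
theorem natConst_mem_SharpP (n : ℕ) : (fun _ : List Bool => n) ∈ SharpP := by
  have h := natFP_mem_SharpP (const_mem_FP (encodeNat n))
  simpa using h

/-- **Integer constants are in `GapNatPSPACE`.** [cite: FennerFortnowKurtz1994, §3] -/
theorem const_mem_GapNatPSPACE (z : ℤ) : (fun _ : List Bool => z) ∈ GapNatPSPACE := by
  refine ⟨fun _ => z.toNat, sharpP_subset_natPSPACE (natConst_mem_SharpP _), fun _ => (-z).toNat,
    sharpP_subset_natPSPACE (natConst_mem_SharpP _), fun _ => ?_⟩
  show z = ((z.toNat : ℕ) : ℤ) - (((-z).toNat : ℕ) : ℤ)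
  omega

/-- **`GapNatPSPACE` is closed under natural multiples.** [cite: FennerFortnowKurtz1994, §3] -/
theorem nsmul_mem_GapNatPSPACE (n : ℕ) {g : List Bool → ℤ} (h : g ∈ GapNatPSPACE) : (fun x => (n : ℤ) * g x) ∈ GapNatPSPACE := by
  have h' := mul_mem_GapNatPSPACE (const_mem_GapNatPSPACE (n : ℤ)) h
  exact h'

/-- **`GapNatPSPACE` is closed under integer multiples.** [cite: FennerFortnowKurtz1994, §3] -/
theorem zsmul_mem_GapNatPSPACE (z : ℤ) {g : List Bool → ℤ} (h : g ∈ GapNatPSPACE) : (fun x => z * g x) ∈ GapNatPSPACE :=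
  mul_mem_GapNatPSPACE (const_mem_GapNatPSPACE z) h

/-- **`GapNatPSPACE` is closed under powers.** [cite: FennerFortnowKurtz1994, §3] -/
theorem pow_mem_GapNatPSPACE {g : List Bool → ℤ} (h : g ∈ GapNatPSPACE) : ∀ k : ℕ, (fun x => g x ^ k) ∈ GapNatPSPACE
  | 0 => by simpa using const_mem_GapNatPSPACE 1
  | k + 1 => by
    have h' := mul_mem_GapNatPSPACE (pow_mem_GapNatPSPACE h k) h
    simpa [pow_succ] using h'

/-- The value of an `FP` numeral is in `GapNatPSPACE`. [cite: FennerFortnowKurtz1994, §3 (FP ⊆ GapP)] -/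
theorem natFP_mem_GapNatPSPACE {t : List Bool → List Bool} (ht : t ∈ FP) :
    (fun x => (bitsToNat (t x) : ℤ)) ∈ GapNatPSPACE :=
  natPSPACE_mem_GapNatPSPACE (natFP_mem_NatPSPACE ht)

/-- `x ↦ 2^{|t x|} ∈ GapNatPSPACE` for `t ∈ FP`. [cite: FennerFortnowKurtz1994, §3 (exponentials)] -/
theorem two_pow_length_mem_GapNatPSPACE {t : List Bool → List Bool} (ht : t ∈ FP) :
    (fun x => (2 : ℤ) ^ (t x).length) ∈ GapNatPSPACE := by
  have h : (fun v => cnt (t v).length {z | boolPair v z ∈ (⊤ : Language Bool)}) ∈ NatPSPACE :=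
    count_mem_NatPSPACE (P_subset_PSPACE_holds top_mem_P) ht
  have h' := natPSPACE_mem_GapNatPSPACE h
  refine (show (fun v => ((cnt (t v).length {z | boolPair v z ∈ (⊤ : Language Bool)} : ℕ) : ℤ)) =
      fun x => (2 : ℤ) ^ (t x).length from funext fun v => ?_) ▸ h'
  have hc : cnt (t v).length {z | boolPair v z ∈ (⊤ : Language Bool)} = 2 ^ (t v).length :=
    cnt_eq_two_pow_of_forall fun y _ => trivial
  rw [hc]
  push_cast
  rfl

/-- `x ↦ 2^{p(|x|)} ∈ GapNatPSPACE`. [cite: FennerFortnowKurtz1994, §3 (exponentials)] -/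
theorem two_pow_mem_GapNatPSPACE (p : Polynomial ℕ) : (fun x : List Bool => (2 : ℤ) ^ p.eval x.length) ∈ GapNatPSPACE := by
  have h := two_pow_length_mem_GapNatPSPACE (polyFn_mem_FP p)
  simpa [polyFn_apply] using h

/-- **`GapNatPSPACE` is closed under uniform exponential sums**: `v ↦ Σ_{z ∈ {0,1}^{|t v|}} g(⟨v, z⟩)`.
[cite: FennerFortnowKurtz1994, §3 (closure under uniform sums)] -/
theorem sum_mem_GapNatPSPACE {g : List Bool → ℤ} (hg : g ∈ GapNatPSPACE) {t : List Bool → List Bool} (ht : t ∈ FP) :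
    (fun v => ∑ z : List.Vector Bool (t v).length, g (boolPair v z.toList)) ∈ GapNatPSPACE := by
  obtain ⟨a, ha, b, hb, e⟩ := hg
  refine ⟨_, sum_mem_NatPSPACE ha ht, _, sum_mem_NatPSPACE hb ht, fun v => ?_⟩
  show ∑ z : List.Vector Bool (t v).length, g (boolPair v z.toList) =
    ((∑ z : List.Vector Bool (t v).length, a (boolPair v z.toList) : ℕ) : ℤ) -
      ((∑ z : List.Vector Bool (t v).length, b (boolPair v z.toList) : ℕ) : ℤ)
  push_cast
  rw [← Finset.sum_sub_distrib]
  exact Finset.sum_congr rfl fun z _ => e _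

/-- **`GapNatPSPACE` is closed under `FP` preprocessing.** [cite: FennerFortnowKurtz1994, §3] -/
theorem comp_mem_GapNatPSPACE {g : List Bool → ℤ} (hg : g ∈ GapNatPSPACE) {f : List Bool → List Bool} (hf : f ∈ FP) :
    (g ∘ f) ∈ GapNatPSPACE := by
  obtain ⟨a, ha, b, hb, e⟩ := hg
  exact ⟨a ∘ f, comp_mem_NatPSPACE ha hf, b ∘ f, comp_mem_NatPSPACE hb hf, fun x => e (f x)⟩

/-- **Restriction to a `PSPACE` set**: `x ↦ [x ∈ A] · g x ∈ GapNatPSPACE` for `A ∈ PSPACE` (intersect both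
witness relations with `fstP⁻¹ A`). [cite: FennerFortnowKurtz1994, §3] -/
theorem ite_mem_GapNatPSPACE {g : List Bool → ℤ} (hg : g ∈ GapNatPSPACE) {A : Language Bool} (hA : A ∈ PSPACE) :
    (fun x => if x ∈ A then g x else 0) ∈ GapNatPSPACE := by
  obtain ⟨B, hB⟩ := exists_isComplete_PSPACE_holds
  obtain ⟨a, ha, b, hb, e⟩ := hg
  have hres : ∀ {φ : List Bool → ℕ}, φ ∈ NatPSPACE → (fun x => if x ∈ A then φ x else 0) ∈ NatPSPACE := by
    rintro φ ⟨R, hR, p, hφ⟩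
    refine ⟨(fstP ⁻¹' A : Language Bool) ⊓ R, inter_mem_PSPACE_of_complete hB (preimage_mem_PSPACE hA fstP_mem_FP) hR, p,
      fun x => ?_⟩
    show (if x ∈ A then φ x else 0) = _
    rw [countWitnesses_eq_cnt]
    split_ifs with hx
    · rw [hφ x, countWitnesses_eq_cnt]
      exact cnt_congr fun y _ => by simp [memL_preimage, hx]
    · symm
      rw [← Nat.le_zero, ← cnt_congr (E := (∅ : Set (List Bool))) (fun y _ => by simp [memL_preimage, hx])]
      have h0 := cnt_add_cnt_compl (p.eval x.length) (∅ : Set (List Bool))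
      rw [Set.compl_empty, cnt_univ] at h0
      omega
  refine ⟨_, hres ha, _, hres hb, fun x => ?_⟩
  show (if x ∈ A then g x else 0) = (((if x ∈ A then a x else 0 : ℕ)) : ℤ) - (((if x ∈ A then b x else 0 : ℕ)) : ℤ)
  split_ifs with hx
  · exact e x
  · simp

/-- Transport of `PSPACE` membership along pointwise equivalence. [folklore] -/
theorem mem_PSPACE_of_iff' {A : Language Bool} (hA : A ∈ PSPACE) (B : Language Bool)
    (h : ∀ w, w ∈ B ↔ w ∈ A) : B ∈ PSPACE := by
  have hBA : B = A := Set.ext h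
  rw [hBA]
  exact hA

/-! ### Thresholds -/

/-- **Positivity of a `GapNatPSPACE` function is a `PSPACE` predicate**: `{x | 0 < g x} ∈ PSPACE` — the
gap threshold `2^0 < 2·(#₁ − #₂)` of `gapThreshold_mem_PSPACE`, after re-pairing the input as
`⟨x, ε⟩` so that its witness lengths are read off `x`. [cite: FennerFortnowKurtz1994, Proposition 4.2] [cite: Ladner1989, §1 (♮PSPACE = FPSPACE(poly))] -/
theorem pos_mem_PSPACE {g : List Bool → ℤ} (hg : g ∈ GapNatPSPACE) : {x | 0 < g x} ∈ PSPACE := by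
  obtain ⟨B, hB⟩ := exists_isComplete_PSPACE_holds
  obtain ⟨a, ⟨R₁, hR₁, r₁, ha⟩, b, ⟨R₂, hR₂, r₂, hb⟩, e⟩ := hg
  -- re-paired relations `⟨u, y⟩ ↦ ⟨fstP u, y⟩`
  set π : List Bool → List Bool := pairFn (fstP ∘ fstP) sndP with hπ
  have hπFP : π ∈ FP := pairFn_mem_FP (comp_mem_FP fstP_mem_FP fstP_mem_FP) sndP_mem_FP
  have hπ_apply : ∀ u y : List Bool, π (boolPair u y) = boolPair (fstP u) y := fun u y => by simp [hπ]
  have hcw : ∀ (R : Language Bool) (m : ℕ) (x : List Bool),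
      countWitnesses (π ⁻¹' R) m (boolPair x []) = countWitnesses R m x := by
    intro R m x
    rw [countWitnesses_eq_cnt, countWitnesses_eq_cnt]
    exact cnt_congr fun y _ => by rw [Set.mem_setOf_eq, Set.mem_setOf_eq, memL_preimage, hπ_apply, fstP_boolPair]
  have h := gapThreshold_mem_PSPACE hB (preimage_mem_PSPACE hR₁ hπFP) (preimage_mem_PSPACE hR₂ hπFP) r₁ r₂ 0
  have hd : (pairFn id (fun _ => []) : List Bool → List Bool) ∈ FP := pairFn_mem_FP id_mem_FP (const_mem_FP [])
  have key := preimage_mem_PSPACE h hd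
  refine mem_PSPACE_of_iff' key _ fun x => ?_
  change 0 < g x ↔ (2 : ℤ) ^ (0 : Polynomial ℕ).eval (fstP (pairFn id (fun _ => []) x)).length <
    2 * ((countWitnesses (π ⁻¹' R₁) (r₁.eval (fstP (pairFn id (fun _ => []) x)).length) (pairFn id (fun _ => []) x) : ℤ) -
      (countWitnesses (π ⁻¹' R₂) (r₂.eval (fstP (pairFn id (fun _ => []) x)).length) (pairFn id (fun _ => []) x) : ℤ))
  rw [pairFn_apply, id, fstP_boolPair, hcw, hcw, e x, ← ha x, ← hb x, eval_zero, pow_zero]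
  omega

/-- Negativity: `{x | g x < 0} ∈ PSPACE`. [cite: FennerFortnowKurtz1994, Proposition 4.2] -/
theorem neg_mem_PSPACE {g : List Bool → ℤ} (hg : g ∈ GapNatPSPACE) : {x | g x < 0} ∈ PSPACE := by
  refine mem_PSPACE_of_iff' (pos_mem_PSPACE (neg_mem_GapNatPSPACE hg)) _ fun x => ?_
  change g x < 0 ↔ 0 < -g x
  omega

/-- Non-negativity: `{x | 0 ≤ g x} ∈ PSPACE`. [cite: FennerFortnowKurtz1994, Proposition 4.2] -/
theorem nonneg_mem_PSPACE {g : List Bool → ℤ} (hg : g ∈ GapNatPSPACE) : {x | 0 ≤ g x} ∈ PSPACE := by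
  refine mem_PSPACE_of_iff' (compl_mem_PSPACE (neg_mem_PSPACE hg)) _ fun x => ?_
  change 0 ≤ g x ↔ ¬ g x < 0
  exact not_lt.symm

/-- Non-positivity: `{x | g x ≤ 0} ∈ PSPACE`. [cite: FennerFortnowKurtz1994, Proposition 4.2] -/
theorem nonpos_mem_PSPACE {g : List Bool → ℤ} (hg : g ∈ GapNatPSPACE) : {x | g x ≤ 0} ∈ PSPACE := by
  refine mem_PSPACE_of_iff' (compl_mem_PSPACE (pos_mem_PSPACE hg)) _ fun x => ?_
  change g x ≤ 0 ↔ ¬ 0 < g x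
  exact not_lt.symm

/-- Comparison of two `GapNatPSPACE` functions: `{x | g₁ x < g₂ x} ∈ PSPACE`. [cite: FennerFortnowKurtz1994, Proposition 4.2] -/
theorem setOf_lt_mem_PSPACE {g₁ g₂ : List Bool → ℤ} (h₁ : g₁ ∈ GapNatPSPACE) (h₂ : g₂ ∈ GapNatPSPACE) :
    {x | g₁ x < g₂ x} ∈ PSPACE := by
  refine mem_PSPACE_of_iff' (pos_mem_PSPACE (sub_mem_GapNatPSPACE h₂ h₁)) _ fun x => ?_
  change g₁ x < g₂ x ↔ 0 < g₂ x - g₁ x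
  omega

/-- Equality of two `GapNatPSPACE` functions: `{x | g₁ x = g₂ x} ∈ PSPACE`. [cite: FennerFortnowKurtz1994, Proposition 4.2] -/
theorem setOf_eq_mem_PSPACE {g₁ g₂ : List Bool → ℤ} (h₁ : g₁ ∈ GapNatPSPACE) (h₂ : g₂ ∈ GapNatPSPACE) :
    {x | g₁ x = g₂ x} ∈ PSPACE := by
  obtain ⟨B, hB⟩ := exists_isComplete_PSPACE_holds
  refine mem_PSPACE_of_iff' (inter_mem_PSPACE_of_complete hB (compl_mem_PSPACE (setOf_lt_mem_PSPACE h₁ h₂))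
    (compl_mem_PSPACE (setOf_lt_mem_PSPACE h₂ h₁))) _ fun x => ?_
  change g₁ x = g₂ x ↔ ¬ g₁ x < g₂ x ∧ ¬ g₂ x < g₁ x
  omega

end Literature.Computability.Complexity

end
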